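import Summits.NavierStokesRegularity.FluidComputer.DesignedBlowupRegularity
import Summits.NavierStokesRegularity.FluidComputer.PalasekTowerClayBridgeUniquenessHolds
import HarnessLib

/-!
# `ClayBlowup ν`: Leray's époque d'irrégularité for Clay data WITH a Clay force — the weakest
# E–C object, its closer to Fefferman's (C), and `DesignedBlowup ν → ClayBlowup ν`

Cell `ns-blowup`, seat `ns-blowup-ecbridge-2` (g5; the E–C endpoint theory seat). LABEL: E–C typing
(KERNEL — no named fact). WHAT THIS IS NOT: not Navier–Stokes evidence — a TYPE (no inhabitant is
claimed anywhere) and what ONE inhabitant at ONE viscosity would give. Companion memo: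
`run/shared/lean/pub/ns-blowup/ecbridge2/ECBRIDGE-2-MEMO-4.md`.

## Why a second type

`DesignedBlowup ν` (`DesignedBlowupClayBridge.lean`) asks that the design admit NO classical extension
past `T` whatsoever (`¬ HasSmoothExtensionPast`). The closer to (C) uses much less: only that no
FINITE-ENERGY classical solution continues the design past `T` — the Clay competitor it has to exclude
is such a continuation. This file isolates that weaker clause:

* `HasFiniteEnergyExtensionPast ν f u T` — a classical solution of the same forced system on some
  `[0, T')`, `T' > T`, agreeing with `u` on `[0, T)`, with finite energy on every closed sub-slab of
  `[0, T')`; it implies `HasSmoothExtensionPast` (`HasFiniteEnergyExtensionPast.hasSmoothExtensionPast`);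
* `ClayBlowup ν` — classical forced solution on `[0, T)`, Clay datum (4), Clay force (5)–(6) (smooth
  THROUGH `T`), finite energy on every closed sub-slab, and `¬ HasFiniteEnergyExtensionPast`: the
  finite-energy classical evolution of `(u(0), f)` has the finite lifespan `T` (Leray 1934, §32:
  «époque d'irrégularité»);
* `DesignedBlowup.toClayBlowup` — every designed blow-up is one;
* `ClayBlowup.eq_of_classical` (W14, the tree THEOREM `tao_unconditional_uniqueness_velocity_forced_holds`:
  any finite-energy classical solution from the same datum coincides with the blow-up on its slab),
  `ClayBlowup.not_exists_claySolution`, `ClayBlowup.clay_breakdown_at` — the `ν`-instance of (C);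
* `ClayBlowup.rescale` (one viscosity gives all) and the closers
  `navierStokesBreakdownR3_of_clayBlowup : 0 < μ → ClayBlowup μ → NavierStokesBreakdownR3`,
  `navierStokesBreakdownR3_of_forall_clayBlowup`.

The CONVERSE — Fefferman's (C) at `ν` GIVES a `ClayBlowup ν` (maximal finite-energy classical
evolution of the Clay data) — is the companion file `ClayBlowupOfBreakdown.lean`; together:
`NavierStokesBreakdownR3 ↔ ∀ ν > 0, Nonempty (ClayBlowup ν)`.

References: C. L. Fefferman, Clay problem description, (C) with (4)–(7) [cite: FeffermanClay2006, (C)];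
J. Leray, Acta Math. 63 (1934), §32 [cite: Leray1934, §32]; T. Tao, Anal. PDE 6 (2013) =
arXiv:1108.1165, Cor. 11.4 and footnote 3 [cite: Tao2011, Cor. 11.4]; J. T. Beale, T. Kato, A. Majda,
Comm. Math. Phys. 94 (1984) §1 [cite: BealeKatoMajda1984, §1].
-/

noncomputable section

namespace Summit.NavierStokesRegularity.FluidComputer

open Set MeasureTheory Filter Topology Function
open scoped ENNReal ContDiff NNReal
open Literature.Analysis.FluidPDE
open Summit.NavierStokesRegularity.NavierStokesRegularity
open Summit.NavierStokesRegularity.NavierStokesRegularity.Theorems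
open Summit.NavierStokesRegularity.FluidComputer.PalasekTowerClayBridge

/-! ## §1 Finite-energy extensions -/

/-- **The classical solution `u` on `[0, T)` extends past `T` IN THE FINITE-ENERGY CLASS**: there are
`T' > T` and a classical solution `(u', p')` of the same forced system on `[0, T') × ℝ³` whose
velocity agrees with `u` on `[0, T)` and whose energy is bounded on every closed sub-slab `[0, T'']`,
`T'' < T'` (Beale–Kato–Majda's continuation, restricted to Leray's finite-energy class).
[cite: BealeKatoMajda1984, §1] [cite: Leray1934, §32] -/
def HasFiniteEnergyExtensionPast (ν : ℝ)
    (f u : ℝ → EuclideanSpace ℝ (Fin 3) → EuclideanSpace ℝ (Fin 3)) (T : ℝ) : Prop :=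
  ∃ T' > T, ∃ (u' : ℝ → EuclideanSpace ℝ (Fin 3) → EuclideanSpace ℝ (Fin 3))
    (p' : ℝ → EuclideanSpace ℝ (Fin 3) → ℝ),
    IsClassicalNSSolutionOn (Ico 0 T') ν f u' p' ∧ (∀ t ∈ Ico 0 T, u' t = u t) ∧
      ∀ T'', T'' < T' → ∃ C : ℝ≥0∞, C < ⊤ ∧ ∀ t ∈ Icc 0 T'', ∫⁻ x, ‖u' t x‖ₑ ^ 2 ≤ C

/-- A finite-energy extension is an extension. [cite: BealeKatoMajda1984, §1] -/
theorem HasFiniteEnergyExtensionPast.hasSmoothExtensionPast {ν T : ℝ}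
    {f u : ℝ → EuclideanSpace ℝ (Fin 3) → EuclideanSpace ℝ (Fin 3)}
    (h : HasFiniteEnergyExtensionPast ν f u T) : HasSmoothExtensionPast ν f u T := by
  obtain ⟨T', hT', u', p', hcl, heq, -⟩ := h
  exact ⟨T', hT', u', p', hcl, heq⟩

/-- **A classical solution on a longer half-open slab with finite slab energies is a finite-energy
extension of its own restriction.** [cite: BealeKatoMajda1984, §1] -/
theorem hasFiniteEnergyExtensionPast_of_Ico {ν T T' : ℝ} (hTT' : T < T')
    {f u : ℝ → EuclideanSpace ℝ (Fin 3) → EuclideanSpace ℝ (Fin 3)}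
    {p : ℝ → EuclideanSpace ℝ (Fin 3) → ℝ} (h : IsClassicalNSSolutionOn (Ico 0 T') ν f u p)
    (hE : ∀ T'', T'' < T' → ∃ C : ℝ≥0∞, C < ⊤ ∧ ∀ t ∈ Icc 0 T'', ∫⁻ x, ‖u t x‖ₑ ^ 2 ≤ C) :
    HasFiniteEnergyExtensionPast ν f u T :=
  ⟨T', hTT', u, p, h, fun _ _ => rfl, hE⟩

/-- **A classical solution on a longer CLOSED slab with finite energy is a finite-energy extension
past `T` of anything it agrees with on `[0, T)`.** [cite: BealeKatoMajda1984, §1] -/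
theorem hasFiniteEnergyExtensionPast_of_Icc {ν T T' : ℝ} (hTT' : T < T')
    {f u U : ℝ → EuclideanSpace ℝ (Fin 3) → EuclideanSpace ℝ (Fin 3)}
    {P : ℝ → EuclideanSpace ℝ (Fin 3) → ℝ} (h : IsClassicalNSSolutionOn (Icc 0 T') ν f U P)
    (heq : ∀ t ∈ Ico 0 T, U t = u t)
    (hE : ∃ C : ℝ≥0∞, C < ⊤ ∧ ∀ t ∈ Icc 0 T', ∫⁻ x, ‖U t x‖ₑ ^ 2 ≤ C) :
    HasFiniteEnergyExtensionPast ν f u T := by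
  refine ⟨T', hTT', U, P, h.mono Ico_subset_Icc_self (uniqueDiffOn_Ico 0 T'), heq, fun T'' hT'' => ?_⟩
  obtain ⟨C, hC, hb⟩ := hE
  exact ⟨C, hC, fun t ht => hb t ⟨ht.1, ht.2.trans hT''.le⟩⟩

/-! ## §2 The type -/

/-- **A Clay blow-up at viscosity `ν` (Leray's époque d'irrégularité with a Clay force).** A time
`T > 0`; an exact classical solution `(u, p)` of `∂ₜu + (u·∇)u = νΔu − ∇p + f`, `div u = 0` on
`[0, T) × ℝ³`; Clay datum (Fefferman (4)) and Clay force (`f ∈ C^∞([0, ∞) × ℝ³)`, smooth THROUGH `T`,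
with the space-time decay (5)); finite energy on every closed sub-slab `[0, T']`, `T' < T`; and NO
finite-energy classical solution of the same forced system continues `u` past `T`. Weaker than
`DesignedBlowup ν` (which forbids every classical extension). A TYPE; no inhabitant is asserted
anywhere in the tree. [cite: FeffermanClay2006, (C) (4) (5) (6)] [cite: Leray1934, §32] -/
structure ClayBlowup (ν : ℝ) where
  /-- the lifespan of the finite-energy classical evolution -/
  T : ℝ
  T_pos : 0 < T
  /-- velocity on `[0, T) × ℝ³` (values for `t ≥ T` are irrelevant) -/
  u : ℝ → EuclideanSpace ℝ (Fin 3) → EuclideanSpace ℝ (Fin 3)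
  /-- pressure -/
  p : ℝ → EuclideanSpace ℝ (Fin 3) → ℝ
  /-- the force, on all of `[0, ∞) × ℝ³` -/
  f : ℝ → EuclideanSpace ℝ (Fin 3) → EuclideanSpace ℝ (Fin 3)
  /-- exact classical forced Navier–Stokes on `[0, T)` -/
  classical : IsClassicalNSSolutionOn (Ico 0 T) ν f u p
  /-- `T` is the finite-energy lifespan: no finite-energy classical continuation past `T` -/
  no_energy_extension : ¬ HasFiniteEnergyExtensionPast ν f u T
  /-- Clay datum (4) -/
  datum_decay : HasRapidSpatialDecay (u 0)
  /-- Clay force (6): smooth on the closed half-space, in particular THROUGH `T` -/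
  force_smooth : IsSmoothOnHalfSpace f
  /-- Clay force (5) -/
  force_decay : HasRapidSpaceTimeDecay f
  /-- finite energy on every closed sub-slab before `T` -/
  energy : ∀ T', T' < T → ∃ C : ℝ≥0∞, C < ⊤ ∧ ∀ t ∈ Icc 0 T', ∫⁻ x, ‖u t x‖ₑ ^ 2 ≤ C

/-- **Every designed blow-up is a Clay blow-up** (a finite-energy extension is an extension).
[cite: FeffermanClay2006, (C)] -/
def DesignedBlowup.toClayBlowup {ν : ℝ} (D : DesignedBlowup ν) : ClayBlowup ν where
  T := D.T
  T_pos := D.T_pos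
  u := D.u
  p := D.p
  f := D.f
  classical := D.classical
  no_energy_extension := fun h => D.no_extension h.hasSmoothExtensionPast
  datum_decay := D.datum_decay
  force_smooth := D.force_smooth
  force_decay := D.force_decay
  energy := D.energy

namespace ClayBlowup

variable {ν : ℝ} (X : ClayBlowup ν)

/-! ## §3 Bookkeeping -/

/-- The datum of a Clay blow-up is smooth. [folklore] -/
theorem contDiff_datum : ContDiff ℝ ∞ (X.u 0) :=
  X.classical.contDiff_velocity (t := 0) ⟨le_rfl, X.T_pos⟩

/-- The datum of a Clay blow-up is divergence free. [folklore] -/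
theorem divFree_datum : NSWave0.IsDivFree (X.u 0) :=
  X.classical.divFree 0 ⟨le_rfl, X.T_pos⟩

/-- The datum of a Clay blow-up is in `H¹`: `u(0), ∇u(0) ∈ L²` (Schwartz ⇒ `H¹`). [folklore] -/
theorem memLp_datum : MemLp (X.u 0) 2 volume ∧ MemLp (fderiv ℝ (X.u 0)) 2 volume :=
  ClayUniqueness.memLp_two_of_rapidDecay X.datum_decay (X.contDiff_datum.of_le (by norm_cast))

/-- A Clay blow-up is classical on every closed sub-slab `[0, T']`, `0 < T' < T`. [folklore] -/
theorem classical_Icc {T' : ℝ} (hT'0 : 0 < T') (hT' : T' < X.T) :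
    IsClassicalNSSolutionOn (Icc 0 T') ν X.f X.u X.p :=
  X.classical.mono (Icc_subset_Ico_right hT') (uniqueDiffOn_Icc hT'0)

/-- **A Clay blow-up is bounded on every closed sub-slab** (`ν > 0`; Tao's class from the slab energy,
Clay datum and force, then Sobolev — `exists_norm_le_of_energy`, no named fact).
[cite: Tao2011, Cor. 11.1] -/
theorem exists_norm_le (hν : 0 < ν) {T' : ℝ} (hT' : T' < X.T) :
    ∃ B : ℝ, ∀ t ∈ Icc 0 T', ∀ x, ‖X.u t x‖ ≤ B :=
  exists_norm_le_of_energy hν X.T_pos X.classical X.datum_decay X.force_smooth X.force_decay X.energy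
    T' hT'

/-! ## §4 Uniqueness against finite-energy classical solutions and against Clay competitors -/

/-- **W14 on the type**: a finite-energy classical solution of the same forced system on a closed
sub-slab `[0, T']`, `0 < T' < T`, with the same datum coincides with the Clay blow-up there — the tree
THEOREM `tao_unconditional_uniqueness_velocity_forced_holds` (Tao 2013, Cor. 11.4 WITH force).
[cite: Tao2011, Cor. 11.4] -/
theorem eq_of_classical (hν : 0 < ν) {T' : ℝ} (hT'0 : 0 < T') (hT' : T' < X.T)
    {v : ℝ → EuclideanSpace ℝ (Fin 3) → EuclideanSpace ℝ (Fin 3)}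
    {q : ℝ → EuclideanSpace ℝ (Fin 3) → ℝ}
    (hv : IsClassicalNSSolutionOn (Icc 0 T') ν X.f v q)
    (hEv : ∃ C : ℝ≥0∞, C < ⊤ ∧ ∀ t ∈ Icc 0 T', ∫⁻ x, ‖v t x‖ₑ ^ 2 ≤ C) (h0 : v 0 = X.u 0) :
    ∀ t ∈ Icc 0 T', v t = X.u t := by
  obtain ⟨hL2, hH1⟩ := X.memLp_datum
  intro t ht
  exact (tao_unconditional_uniqueness_velocity_forced_holds ν T' hν hT'0 (X.u 0) hL2 hH1 X.f
    X.force_smooth X.force_decay X.u v X.p q (X.classical_Icc hT'0 hT') hv rfl h0 (X.energy T' hT')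
    hEv t ht).symm

/-- **A global Clay-class solution with the same datum and force coincides with the Clay blow-up on
`[0, T)`** (W14 on each closed sub-slab `[0, t']`, `t < t' < T`). No named fact.
[cite: Tao2011, Cor. 11.4] -/
theorem eq_of_claySolution (hν : 0 < ν)
    {v : ℝ → EuclideanSpace ℝ (Fin 3) → EuclideanSpace ℝ (Fin 3)}
    {q : ℝ → EuclideanSpace ℝ (Fin 3) → ℝ}
    (hv : IsSmoothOnHalfSpace v) (hq : IsSmoothOnHalfSpace q)
    (hns : IsNavierStokesSolution ν X.f (X.u 0) v q) (hE : HasBoundedEnergy v) :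
    ∀ t ∈ Ico 0 X.T, v t = X.u t := by
  intro t ht
  obtain ⟨ht0, htT⟩ := ht
  obtain ⟨t', htt', ht'T⟩ := exists_between htT
  have ht'0 : 0 < t' := lt_of_le_of_lt ht0 htt'
  obtain ⟨hcl, h0⟩ := isNavierStokesSolution_and_smooth_iff.1 ⟨hns, hv, hq⟩
  have hclv : IsClassicalNSSolutionOn (Icc 0 t') ν X.f v q :=
    hcl.mono Icc_subset_Ici_self (uniqueDiffOn_Icc ht'0)
  have hEv : ∃ C : ℝ≥0∞, C < ⊤ ∧ ∀ s ∈ Icc 0 t', ∫⁻ x, ‖v s x‖ₑ ^ 2 ≤ C := by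
    obtain ⟨C, hC, hb⟩ := hE
    exact ⟨C, hC, fun s hs => hb s hs.1⟩
  exact X.eq_of_classical hν ht'0 ht'T hclv hEv h0 t ⟨ht0, htt'.le⟩

/-- **No global Clay-class solution shares the datum and force of a Clay blow-up**: such a solution
would coincide with the blow-up on `[0, T)` (`eq_of_claySolution`), so its restriction to `[0, T+1)`
would be a FINITE-ENERGY classical extension past `T` (its energy is bounded on `[0, ∞)`), which
`no_energy_extension` forbids. [cite: FeffermanClay2006, (C)] -/
theorem not_exists_claySolution (hν : 0 < ν) :
    ¬ ∃ (v : ℝ → EuclideanSpace ℝ (Fin 3) → EuclideanSpace ℝ (Fin 3))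
        (q : ℝ → EuclideanSpace ℝ (Fin 3) → ℝ),
        IsSmoothOnHalfSpace v ∧ IsSmoothOnHalfSpace q ∧
          IsNavierStokesSolution ν X.f (X.u 0) v q ∧ HasBoundedEnergy v := by
  rintro ⟨v, q, hv, hq, hns, hE⟩
  have heq : ∀ t ∈ Ico 0 X.T, v t = X.u t := X.eq_of_claySolution hν hv hq hns hE
  have hclv : IsClassicalNSSolutionOn (Ici 0) ν X.f v q :=
    (isNavierStokesSolution_and_smooth_iff.1 ⟨hns, hv, hq⟩).1
  have hT1 : X.T < X.T + 1 := by linarith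
  have hclv' : IsClassicalNSSolutionOn (Ico 0 (X.T + 1)) ν X.f v q :=
    hclv.mono (fun s hs => hs.1) (uniqueDiffOn_Ico 0 (X.T + 1))
  refine X.no_energy_extension ⟨X.T + 1, hT1, v, q, hclv', heq, fun T'' _ => ?_⟩
  obtain ⟨C, hC, hb⟩ := hE
  exact ⟨C, hC, fun s hs => hb s hs.1⟩

/-- **The `ν`-instance of Fefferman's (C) from ONE Clay blow-up at viscosity `ν`.**
[cite: FeffermanClay2006, (C)] -/
theorem clay_breakdown_at (X : ClayBlowup ν) (hν : 0 < ν) :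
    ∃ (u₀ : EuclideanSpace ℝ (Fin 3) → EuclideanSpace ℝ (Fin 3))
      (f : ℝ → EuclideanSpace ℝ (Fin 3) → EuclideanSpace ℝ (Fin 3)),
      ContDiff ℝ ∞ u₀ ∧ NSWave0.IsDivFree u₀ ∧ HasRapidSpatialDecay u₀ ∧
      IsSmoothOnHalfSpace f ∧ HasRapidSpaceTimeDecay f ∧
        ¬ ∃ (u : ℝ → EuclideanSpace ℝ (Fin 3) → EuclideanSpace ℝ (Fin 3))
            (p : ℝ → EuclideanSpace ℝ (Fin 3) → ℝ),
            IsSmoothOnHalfSpace u ∧ IsSmoothOnHalfSpace p ∧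
              IsNavierStokesSolution ν f u₀ u p ∧ HasBoundedEnergy u :=
  ⟨X.u 0, X.f, X.contDiff_datum, X.divFree_datum, X.datum_decay, X.force_smooth, X.force_decay,
    X.not_exists_claySolution hν⟩

/-! ## §5 One viscosity gives all -/

/-- **Change of viscosity for Clay blow-ups.** A Clay blow-up at viscosity `μ > 0` yields one at any
`ν > 0`: with `a = ν/μ`, `u ↦ a·u(a t, x)`, `p ↦ a²·p(a t, x)`, `f ↦ a²·f(a t, x)`, `T ↦ T/a`
(tree `isClassicalNSSolutionOn_viscosityChange`); Clay classes and slab energies are preserved, and a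
finite-energy extension of the dilated solution past `T/a` dilates back (factor `a⁻¹`, energies
scaled by `a⁻²`) to a finite-energy extension of the original past `T`. [cite: Tao2011, footnote 3] -/
def rescale {μ : ℝ} (X : ClayBlowup μ) (hμ : 0 < μ) (hν : 0 < ν) : ClayBlowup ν :=
  let a : ℝ := ν / μ
  have ha : 0 < a := div_pos hν hμ
  have haμ : a * μ = ν := div_mul_cancel₀ ν hμ.ne'
  have hmaps : MapsTo (fun s => a * s) (Ico (0 : ℝ) (X.T / a)) (Ico 0 X.T) := fun s hs =>
    ⟨mul_nonneg ha.le hs.1, by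
      have := mul_lt_mul_of_pos_left hs.2 ha
      rwa [mul_div_cancel₀ _ ha.ne'] at this⟩
  { T := X.T / a
    T_pos := div_pos X.T_pos ha
    u := timeRescale a a X.u
    p := timeRescale a (a ^ 2) X.p
    f := timeRescale a (a ^ 2) X.f
    classical := by
      have h := isClassicalNSSolutionOn_viscosityChange X.classical a hmaps
        (uniqueDiffOn_Ico 0 (X.T / a))
      rwa [haμ] at h
    no_energy_extension := by
      rintro ⟨T', hT', u', p', hcl', heq, hE'⟩
      -- dilate the extension back with the factor `b = a⁻¹`
      set b : ℝ := a⁻¹ with hb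
      have hb0 : 0 < b := inv_pos.2 ha
      have hba : b * a = 1 := inv_mul_cancel₀ ha.ne'
      have hmaps' : MapsTo (fun s => b * s) (Ico (0 : ℝ) (a * T')) (Ico 0 T') := fun s hs =>
        ⟨mul_nonneg hb0.le hs.1, by
          have := mul_lt_mul_of_pos_left hs.2 hb0
          rwa [← mul_assoc, hba, one_mul] at this⟩
      have hcl'' := isClassicalNSSolutionOn_viscosityChange hcl' b hmaps' (uniqueDiffOn_Ico 0 (a * T'))
      have hbν : b * ν = μ := by
        rw [← haμ, ← mul_assoc, hba, one_mul]
      rw [hbν] at hcl''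
      have hff : timeRescale b (b ^ 2) (timeRescale a (a ^ 2) X.f) = X.f :=
        DesignedBlowup.timeRescale_timeRescale_of_mul_eq_one hba (by rw [← mul_pow, hba, one_pow]) X.f
      rw [hff] at hcl''
      refine X.no_energy_extension
        ⟨a * T', ?_, timeRescale b b u', timeRescale b (b ^ 2) p', hcl'', ?_, ?_⟩
      · have := mul_lt_mul_of_pos_left hT' ha
        rwa [mul_div_cancel₀ _ ha.ne'] at this
      · intro t ht
        have hbt : b * t ∈ Ico 0 (X.T / a) := by
          refine ⟨mul_nonneg hb0.le ht.1, ?_⟩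
          rw [hb, div_eq_inv_mul]
          exact mul_lt_mul_of_pos_left ht.2 hb0
        rw [timeRescale_slice, heq (b * t) hbt, ← timeRescale_slice,
          DesignedBlowup.timeRescale_timeRescale_of_mul_eq_one hba hba X.u]
      · intro T'' hT''
        have hbT'' : b * T'' < T' := by
          have := mul_lt_mul_of_pos_left hT'' hb0
          rwa [← mul_assoc, hba, one_mul] at this
        obtain ⟨C, hC, hbd⟩ := hE' (b * T'') hbT''
        refine ⟨ENNReal.ofReal (b ^ 2) * C, ENNReal.mul_lt_top ENNReal.ofReal_lt_top hC,
          fun t ht => ?_⟩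
        simp only [timeRescale_apply]
        rw [lintegral_enorm_sq_const_smul]
        exact mul_le_mul_right (hbd (b * t) ⟨mul_nonneg hb0.le ht.1,
          mul_le_mul_of_nonneg_left ht.2 hb0.le⟩) _
    datum_decay := by
      rw [timeRescale_zero]
      exact hasRapidSpatialDecay_const_smul X.datum_decay X.contDiff_datum a
    force_smooth := isSmoothOnHalfSpace_timeRescale X.force_smooth ha.le _
    force_decay := hasRapidSpaceTimeDecay_timeRescale X.force_smooth X.force_decay ha _
    energy := by
      intro T' hT'
      have haT' : a * T' < X.T := by
        have := mul_lt_mul_of_pos_left hT' ha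
        rwa [mul_div_cancel₀ _ ha.ne'] at this
      obtain ⟨C, hC, hbd⟩ := X.energy (a * T') haT'
      refine ⟨ENNReal.ofReal (a ^ 2) * C, ENNReal.mul_lt_top ENNReal.ofReal_lt_top hC,
        fun t ht => ?_⟩
      simp only [timeRescale_apply]
      rw [lintegral_enorm_sq_const_smul]
      exact mul_le_mul_right (hbd (a * t) ⟨mul_nonneg ha.le ht.1,
        mul_le_mul_of_nonneg_left ht.2 ha.le⟩) _ }

end ClayBlowup

/-! ## §6 The closers -/

/-- **ONE Clay blow-up, at ONE viscosity, gives Fefferman's (C).** At the given `μ` by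
`ClayBlowup.clay_breakdown_at`; at every other `ν > 0` after `ClayBlowup.rescale`. Conditional on the
inhabitant only (none is asserted). [cite: FeffermanClay2006, (C)] [cite: Tao2011, footnote 3] -/
theorem navierStokesBreakdownR3_of_clayBlowup {μ : ℝ} (hμ : 0 < μ) (X : ClayBlowup μ) :
    Summit.NavierStokesRegularity.NavierStokesRegularity.NavierStokesBreakdownR3 :=
  fun _ν hν => (X.rescale hμ hν).clay_breakdown_at hν

/-- The `∀ ν` form: Clay blow-ups at every viscosity give (C) (no rescaling needed).
[cite: FeffermanClay2006, (C)] -/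
theorem navierStokesBreakdownR3_of_forall_clayBlowup (h : ∀ ν : ℝ, 0 < ν → Nonempty (ClayBlowup ν)) :
    Summit.NavierStokesRegularity.NavierStokesRegularity.NavierStokesBreakdownR3 := by
  intro ν hν
  obtain ⟨X⟩ := h ν hν
  exact X.clay_breakdown_at hν

/-- The `∃ ν` form: a Clay blow-up at SOME positive viscosity gives (C).
[cite: FeffermanClay2006, (C)] [cite: Tao2011, footnote 3] -/
theorem navierStokesBreakdownR3_of_exists_clayBlowup (h : ∃ ν : ℝ, 0 < ν ∧ Nonempty (ClayBlowup ν)) :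
    Summit.NavierStokesRegularity.NavierStokesRegularity.NavierStokesBreakdownR3 := by
  obtain ⟨μ, hμ, ⟨X⟩⟩ := h
  exact navierStokesBreakdownR3_of_clayBlowup hμ X

/-- Literature spelling of (C) (`Literature.Analysis.FluidPDE.NavierStokesBreakdownR3`).
[cite: FeffermanClay2006, (C)] -/
theorem literature_navierStokesBreakdownR3_of_clayBlowup {μ : ℝ} (hμ : 0 < μ) (X : ClayBlowup μ) :
    Literature.Analysis.FluidPDE.NavierStokesBreakdownR3 :=
  navierStokesBreakdownR3_iff_literature.1 (navierStokesBreakdownR3_of_clayBlowup hμ X)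

end Summit.NavierStokesRegularity.FluidComputer

end
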